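import Summits.BirchSwinnertonDyer.BirchSwinnertonDyer.Theorems.KimAtThreeDeepUpperEndCore
import Summits.BirchSwinnertonDyer.BirchSwinnertonDyer.Theorems.KimAtThreeDeepUpperSupplyGlue
import HarnessLib

/-!
# Route `KimAtThreeKolyvagin` (rung W2), crux `DeepUpperAtThree`: the ROW-LEVEL composition —
# END-core inputs at every depth ⟹ the conclusion of crux 19076 at the row

Cell `bsd-addord`, seat `bsd-addord-w2-c3` (D-0074 row B6), item `stmt-BirchSwinnertonDyer-19076`.
Sequel of `KimAtThreeDeepUpperEndCore` (`EndCore.exists_certificate_of_witnessAt`: at ONE deep level,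
cell n1011's DICT3 witness clauses `KatoKuriharaWitnessAt` + a generator of `KS₁` + the Poitou–Tate
count + the STUB decomposition at `∅` + `#Sel_{3^K} = #Ш(3)` + the `L`-value visibility + ONE good core
vertex ⟹ an explicit Kurihara-number certificate of depth `≤ ∂⁽⁰⁾ − ord₃ #Ш(3) + 1`). Here:
* `EndRow.padicValNat_sha_le_of_witnessAt` — the same inputs give `ord₃ #Ш(E/ℚ)(3) ≤ ∂⁽⁰⁾(δ̃)` (upper
  ledger at `∅`: `s ≤ t + a − α`; every dictionary value is a multiple of `3^t`, so the unit at the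
  vertex forces `t ≤ α`);
* **`EndRow.deepUpper_conclusion_of_endCoreInputs`** — if such inputs exist at EVERY depth
  `k₀ > ∂⁽⁰⁾ − ord₃ #Ш(3)` (with the vertex level in `𝒩_{k₀}(E,3)`, `ν ≤ B`), then
  `∃ d, ∂^{(∞)}_{deep}(δ̃) = d ∧ ord₃ #Ш(E/ℚ)(3) + d ≤ ∂⁽⁰⁾(δ̃)` — crux 19076 at the row (`f = P.f`),
  via `KimAtThreeDeepUpperSupplyGlue.deepUpper_conclusion_of_supplyWitnesses_bounded`.
READING: with this file the Kato side of crux 19076 is, in the kernel, exactly the PRODUCTION of the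
END-core inputs at every depth: the dictionary port (n1011 `KatoKuriharaPortThreeAt`, one
`obtain` away from `KatoKuriharaWitnessAt`; on Kodaira IV/IV* its two-exponent form), [S24] Thm. 4.4 (1)
(generator), the STUB port at `∅` (Rubin 2011 Thm. 2.8.4 at `p = 3`), good core vertices at every depth
(Chebotarev), the count (n1011 `DeepLedger.natCard_selmerGroup_propagated_atLevel_eq`), `Sel = Ш`
(`KimAtThreeDeepUpperSelmerSha`) and the `L`-value (n1011 `LValue.exists_lValue_witness`). TOOL
theorems; every input a hypothesis; nothing asserted about any curve.
[cite: Kim2022StructureSelmer, Thm. 1.9 (6), Thm. 3.13, Lemma 3.14] [cite: MazurRubin2004, Thm. 4.3.4, Cor. 4.1.9, Thm. 5.2.12 (v)]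
[cite: Rubin2011, Thm. 2.8.4 (p. 25)] [cite: Sakamoto2024, Thm. 4.4 (1) (p. 926)] [cite: Kim2025RefinedTNC, Thm 1.1, §5, Lemma 5.2]
-/

set_option autoImplicit false
-- the Theorems namespace of a single-conjunct summit repeats the summit name by design (D-0017)
set_option linter.dupNamespace false

noncomputable section

open scoped Classical NumberField ContRepresentation
open Function NumberField IsDedekindDomain WeierstrassCurve CongruenceSubgroup
  Literature.NumberTheory.EllipticCurves Literature.NumberTheory.EllipticCurves.ModularForms
  Literature.NumberTheory.EllipticCurves.Rank1Residual
  Literature.NumberTheory.GaloisRepresentations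
  Literature.NumberTheory.GaloisRepresentations.DiscreteGaloisModule Literature.NumberTheory.GaloisCohomology

namespace Summit.BirchSwinnertonDyer.BirchSwinnertonDyer.Theorems.KimAtThreeDeepUpperEndRow

open Summit.BirchSwinnertonDyer.Rank1Residual.GaloisImage
open Summit.BirchSwinnertonDyer.BirchSwinnertonDyer.Theorems
open KimAtThreeDeepUpperLedger KimAtThreeDeepUpperSupplyLedger KimAtThreeDeepUpperEndCore

namespace EndRow

/-! ## `ord₃ #Ш(3) ≤ ∂⁽⁰⁾` from the END-core inputs, and the row-level composition -/

/-- **`ord₃ #Ш(E/ℚ)(3) ≤ ∂⁽⁰⁾(δ̃)` from the END-core inputs** (upper ledger at `∅`: `s ≤ t + a − α`;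
the unit at the good core vertex forces `t ≤ α`, since every dictionary value is a multiple of `3^t`).
[cite: Kim2022StructureSelmer, Thm. 3.13, Lemma 3.14] [cite: Rubin2011, Thm. 2.8.4 (p. 25)] -/
theorem padicValNat_sha_le_of_witnessAt
    (W : WeierstrassCurve ℚ) [W.IsElliptic] [W.IsGloballyMinimal]
    (t k : ℕ) (D : KolyvaginDatum (W.torsionGaloisModule (((3 : ℕ) : ℤ) ^ k * ((3 : ℕ) : ℤ))))
    (v₃ : HeightOneSpectrum (𝓞 ℚ)) (hv₃ : ((3 : ℕ) : 𝓞 ℚ) ∈ v₃.asIdeal)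
    {N : ℕ} [NeZero N] (P : ModularParametrizationData W N)
    {κ : Finset (HeightOneSpectrum (𝓞 ℚ)) →
      galoisCohomology (W.torsionGaloisModule (((3 : ℕ) : ℤ) ^ k * ((3 : ℕ) : ℤ))) 1}
    {Λ : galoisCohomology ((W.torsionGaloisModule (((3 : ℕ) : ℤ) ^ k * ((3 : ℕ) : ℤ))).toLocal
      (Sum.inr v₃)) 1 →+ ZMod (3 ^ (k + 1))}
    {κ' : Finset (HeightOneSpectrum (𝓞 ℚ)) →
      galoisCohomology (W.torsionGaloisModule (((3 : ℕ) : ℤ) ^ k * ((3 : ℕ) : ℤ))) 1}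
    (hW : KatoKuriharaWitnessAt W k t D v₃ P κ Λ κ')
    (g : Finset (HeightOneSpectrum (𝓞 ℚ)) →
      galoisCohomology (W.torsionGaloisModule (((3 : ℕ) : ℤ) ^ k * ((3 : ℕ) : ℤ))) 1)
    (hgen : ∀ κ'' ∈ D.kolyvaginSystems (propagatedSelmerStructure W 3 k), ∃ a' : ℕ, κ'' = a' • g)
    {n₀ : ℕ} (hcount : Nat.card (propagatedSelmerStructure W 3 k).selmerGroup = 3 ^ (k + 1) * 3 ^ n₀)
    (hstub : ∃ e ∈ (propagatedSelmerStructure W 3 k).selmerGroup,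
      ∃ m ∈ (W.kummerSelmerStructure (((3 : ℕ) : ℤ) ^ k * ((3 : ℕ) : ℤ))).selmerGroup,
        g ∅ = 3 ^ n₀ • e + m)
    (hSelSha : Nat.card (W.kummerSelmerStructure (((3 : ℕ) : ℤ) ^ k * ((3 : ℕ) : ℤ))).selmerGroup =
      Nat.card (AddCommGroup.primaryComponent W.sha 3))
    {a : ℕ} (hta : t + a < k + 1) (w₀ : (ZMod (3 ^ (k + 1)))ˣ)
    (hKur : ∀ ψ : (ℓ : ℕ) → (ZMod ℓ)ˣ →* Multiplicative (ZMod (3 ^ (k + 1))),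
      kuriharaNumber P.f (3 ^ (k + 1)) 1 ψ = ((3 ^ a : ℕ) : ZMod (3 ^ (k + 1))) * (w₀ : ZMod _))
    (d : Finset (HeightOneSpectrum (𝓞 ℚ))) (hd : D.IsLevel d)
    (hinj : ∀ x ∈ (D.atLevel (propagatedSelmerStructure W 3 k) d).selmerGroup,
      Λ (galoisCohomology.localization _ (Sum.inr v₃) 1 x) = 0 → x = 0)
    (hgd : g d ∈ (D.atLevel (propagatedSelmerStructure W 3 k) d).selmerGroup)
    (hord : addOrderOf (g d) = 3 ^ (k + 1)) :
    padicValNat 3 (Nat.card (AddCommGroup.primaryComponent W.sha 3)) ≤ a := by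
  haveI : Fact (Nat.Prime 3) := ⟨Nat.prime_three⟩
  haveI : NeZero (3 ^ (k + 1)) := ⟨pow_ne_zero _ three_ne_zero⟩
  obtain ⟨hκmem, ⟨hκ'KS, hbridge⟩, -, hker, hdict⟩ := hW
  obtain ⟨a', ha'⟩ := hgen κ' hκ'KS
  have hbr₀ : κ' ∅ = κ ∅ := by
    have h := hbridge ∅ D.isLevel_empty
    have hcl : AddSubgroup.closure {x | ∃ c, c ⊂ (∅ : Finset (HeightOneSpectrum (𝓞 ℚ))) ∧ x = κ c}
        = ⊥ := by
      rw [AddSubgroup.closure_eq_bot_iff]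
      rintro x ⟨c, hc, -⟩
      exact absurd hc (Finset.not_ssubset_empty c)
    rw [hcl, AddSubgroup.mem_bot, sub_eq_zero] at h
    exact h
  obtain ⟨u, ψ₀, -, hval₀⟩ := hdict ∅ D.isLevel_empty
  have hδ₁ : Λ (galoisCohomology.localization _ (Sum.inr v₃) 1 (κ ∅)) =
      (u : ZMod (3 ^ (k + 1))) * (3 : ZMod (3 ^ (k + 1))) ^ t *
        (((3 ^ a : ℕ) : ZMod (3 ^ (k + 1))) * (w₀ : ZMod _)) := by
    rw [hval₀]
    congr 1
    have h1 := hKur ψ₀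
    simpa using h1
  have ha'0 : a' ≠ 0 := by
    intro h0
    have hz : κ' ∅ = 0 := by rw [ha', h0, zero_smul, Pi.zero_apply]
    have : Λ (galoisCohomology.localization _ (Sum.inr v₃) 1 (κ ∅)) = 0 := by
      rw [← hbr₀, hz, map_zero, map_zero]
    rw [hδ₁] at this
    have hne := DeepLedger.pow_mul_unit_ne_zero 3 hta (u * w₀)
    apply hne
    rw [← this, Units.val_mul]
    push_cast
    ring
  obtain ⟨α, b, hb, hab⟩ := Nat.exists_eq_pow_mul_and_not_dvd ha'0 3 (by norm_num)
  have hκ'g : ∀ c, κ' c = (3 ^ α * b) • g c := fun c => by rw [ha', hab, Pi.smul_apply]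
  obtain ⟨e, he, m, hm, hstub'⟩ := hstub
  obtain ⟨-, hup⟩ := DeepLedgerUpper.natCard_selmerGroup_kummer_dvd_pow_of_stub_of_kato W 3 k
    (by norm_num) hv₃ Λ hker (κ₀ := κ ∅) (κ₀' := κ' ∅) hbr₀ hta u w₀ rfl
    (by rw [hδ₁]; push_cast; ring) hb (hκ'g ∅) hcount he hm hstub'
  have hsle : padicValNat 3 (Nat.card (AddCommGroup.primaryComponent W.sha 3)) ≤ t + a - α := by
    rw [hSelSha] at hup
    obtain ⟨i, hi, hcard⟩ := (Nat.dvd_prime_pow Nat.prime_three).1 hup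
    rw [hcard, padicValNat.prime_pow]
    exact hi
  -- `t ≤ α`: at the vertex, `Λ(loc κ′_d) = 3^α b · unit` is a multiple of `3^t`
  let L : galoisCohomology (W.torsionGaloisModule (((3 : ℕ) : ℤ) ^ k * ((3 : ℕ) : ℤ))) 1 →+
      ZMod (3 ^ (k + 1)) :=
    Λ.comp (galoisCohomology.localization _ (Sum.inr v₃) 1)
  have hL : ∀ x, L x = Λ (galoisCohomology.localization _ (Sum.inr v₃) 1 x) := fun _ => rfl
  obtain ⟨wg, hwg⟩ := SupplyLedger.isUnit_apply_of_injOn_of_addOrderOf_eq L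
    (D.atLevel (propagatedSelmerStructure W 3 k) d).selmerGroup (fun x hx h0 => hinj x hx h0) hgd hord
  -- every `L(κ_c)`, `c ⊆ d`, lies in `(3^t)`; hence so does `L(κ′_d)`
  set Jt : Ideal (ZMod (3 ^ (k + 1))) := Ideal.span {((3 ^ t : ℕ) : ZMod (3 ^ (k + 1)))} with hJt
  have hJc : ∀ c, c ⊆ d → L (κ c) ∈ Jt := by
    intro c hc
    obtain ⟨uc, ψc, -, hvalc⟩ := hdict c (fun q hq => hd (hc hq))
    rw [hL, hvalc, hJt, Ideal.mem_span_singleton]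
    push_cast
    exact (dvd_mul_left _ _).mul_right _
  have hκ'dJ : L (κ' d) ∈ Jt :=
    (Ledger.apply_mem_iff_of_sub_mem_closure L Jt κ κ' d (hbridge d hd) fun c hc => hJc c hc.subset).2
      (hJc d subset_rfl)
  have htα : t ≤ α := by
    rw [hκ'g d, map_nsmul, ← hwg, nsmul_eq_mul, hJt, Ideal.mem_span_singleton] at hκ'dJ
    have hbcop : Nat.Coprime b (3 ^ (k + 1)) :=
      Nat.Coprime.pow_right _ ((Nat.Prime.coprime_iff_not_dvd Nat.prime_three).2 hb).symm
    have h' : ((3 ^ t : ℕ) : ZMod (3 ^ (k + 1))) ∣ ((3 ^ α : ℕ) : ZMod (3 ^ (k + 1))) *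
        ((ZMod.unitOfCoprime b hbcop * wg : (ZMod (3 ^ (k + 1)))ˣ) : ZMod _) := by
      rw [Units.val_mul, ZMod.coe_unitOfCoprime]
      push_cast at hκ'dJ ⊢
      simpa [mul_assoc] using hκ'dJ
    exact DeepLedgerUpper.le_of_pow_dvd_pow_mul_unit (p := 3) (by omega) _ h'
  omega

open KimAtThreeDeepUpperSupplyGlue in
/-- **Crux 19076 at a row from the END-core inputs at every depth.** On a row (`W` globally minimal,
datum `P`, `3`-integral plus symbols of `P.f`, `∂⁽⁰⁾(δ̃) = a`) suppose that for every depth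
`k₀ > a − ord₃ #Ш(E/ℚ)(3)` the inputs of `exists_certificate_of_witnessAt` exist at some level
`K = k + 1` with the good core vertex in `𝒩_{k₀}(E,3)` and `ν ≤ B` (hypothesis `H`, inline: DICT3
witness clauses, generator, count, STUB at `∅`, `#Sel_{3^K} = #Ш(3)`, `L`-value visibility with
`t + a < K`, one good core vertex). Then `∃ d, ∂^{(∞)}_{deep}(δ̃) = d ∧ ord₃ #Ш(E/ℚ)(3) + d ≤ ∂⁽⁰⁾(δ̃)`
— the conclusion of crux 19076 at the row, for `f = P.f`. [cite: Kim2022StructureSelmer, Thm. 1.9 (6), Thm. 3.13]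
[cite: MazurRubin2004, Thm. 4.3.4, Cor. 4.1.9, Thm. 5.2.12 (v)] [cite: Kim2025RefinedTNC, Thm 1.1, §5] -/
theorem deepUpper_conclusion_of_endCoreInputs
    (W : WeierstrassCurve ℚ) [W.IsElliptic] [W.IsGloballyMinimal] (t : ℕ)
    (v₃ : HeightOneSpectrum (𝓞 ℚ)) (hv₃ : ((3 : ℕ) : 𝓞 ℚ) ∈ v₃.asIdeal)
    {N : ℕ} [NeZero N] (P : ModularParametrizationData W N)
    (hint : ∀ r : ℚ, ratPlusSymbol P.f r ≠ 0 → 0 ≤ padicValRat 3 (ratPlusSymbol P.f r))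
    {a : ℕ} (ha : kuriharaPartial W 3 P.f 0 = a) (B : ℕ)
    (H : ∀ k₀, a - padicValNat 3 (Nat.card (AddCommGroup.primaryComponent W.sha 3)) < k₀ →
      ∃ (k : ℕ) (D : KolyvaginDatum (W.torsionGaloisModule (((3 : ℕ) : ℤ) ^ k * ((3 : ℕ) : ℤ))))
        (κ : Finset (HeightOneSpectrum (𝓞 ℚ)) →
          galoisCohomology (W.torsionGaloisModule (((3 : ℕ) : ℤ) ^ k * ((3 : ℕ) : ℤ))) 1)
        (Λ : galoisCohomology ((W.torsionGaloisModule (((3 : ℕ) : ℤ) ^ k * ((3 : ℕ) : ℤ))).toLocal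
          (Sum.inr v₃)) 1 →+ ZMod (3 ^ (k + 1)))
        (κ' : Finset (HeightOneSpectrum (𝓞 ℚ)) →
          galoisCohomology (W.torsionGaloisModule (((3 : ℕ) : ℤ) ^ k * ((3 : ℕ) : ℤ))) 1)
        (_ : KatoKuriharaWitnessAt W k t D v₃ P κ Λ κ')
        (g : Finset (HeightOneSpectrum (𝓞 ℚ)) →
          galoisCohomology (W.torsionGaloisModule (((3 : ℕ) : ℤ) ^ k * ((3 : ℕ) : ℤ))) 1)
        (_ : ∀ κ'' ∈ D.kolyvaginSystems (propagatedSelmerStructure W 3 k), ∃ a' : ℕ, κ'' = a' • g)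
        (n₀ : ℕ) (_ : Nat.card (propagatedSelmerStructure W 3 k).selmerGroup = 3 ^ (k + 1) * 3 ^ n₀)
        (_ : ∃ e ∈ (propagatedSelmerStructure W 3 k).selmerGroup,
          ∃ m ∈ (W.kummerSelmerStructure (((3 : ℕ) : ℤ) ^ k * ((3 : ℕ) : ℤ))).selmerGroup,
            g ∅ = 3 ^ n₀ • e + m)
        (_ : Nat.card (W.kummerSelmerStructure (((3 : ℕ) : ℤ) ^ k * ((3 : ℕ) : ℤ))).selmerGroup =
          Nat.card (AddCommGroup.primaryComponent W.sha 3))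
        (_ : t + a < k + 1) (w₀ : (ZMod (3 ^ (k + 1)))ˣ)
        (_ : ∀ ψ : (ℓ : ℕ) → (ZMod ℓ)ˣ →* Multiplicative (ZMod (3 ^ (k + 1))),
          kuriharaNumber P.f (3 ^ (k + 1)) 1 ψ = ((3 ^ a : ℕ) : ZMod (3 ^ (k + 1))) * (w₀ : ZMod _))
        (d : Finset (HeightOneSpectrum (𝓞 ℚ))) (_ : D.IsLevel d)
        (_ : ∀ q ∈ d, (Ideal.absNorm q.asIdeal).Prime)
        (_ : IsCyclicKolyvaginLevel W 3 (∏ q ∈ d, Ideal.absNorm q.asIdeal))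
        (_ : Kato.IsKolyvaginProduct W 3 k₀ (∏ q ∈ d, Ideal.absNorm q.asIdeal))
        (_ : (∏ q ∈ d, Ideal.absNorm q.asIdeal).primeFactors.card ≤ B)
        (_ : ∀ x ∈ (D.atLevel (propagatedSelmerStructure W 3 k) d).selmerGroup,
          Λ (galoisCohomology.localization _ (Sum.inr v₃) 1 x) = 0 → x = 0)
        (_ : g d ∈ (D.atLevel (propagatedSelmerStructure W 3 k) d).selmerGroup),
        addOrderOf (g d) = 3 ^ (k + 1)) :
    ∃ dd : ℕ, kuriharaPartialDeepInfty W 3 P.f = dd ∧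
      ((padicValNat 3 (Nat.card (AddCommGroup.primaryComponent W.sha 3)) + dd : ℕ) : ℕ∞) ≤
        kuriharaPartial W 3 P.f 0 := by
  haveI : Fact (Nat.Prime 3) := ⟨Nat.prime_three⟩
  set s := padicValNat 3 (Nat.card (AddCommGroup.primaryComponent W.sha 3)) with hs_def
  -- `s ≤ a` from the inputs at ONE depth
  have hsa : s ≤ a := by
    obtain ⟨k, D, κ, Λ, κ', hW, g, hgen, n₀, hcount, hstub, hSelSha, hta, w₀, hKur, d, hd, -, -, -, -,
      hinj, hgd, hord⟩ := H (a - s + 1) (by omega)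
    exact padicValNat_sha_le_of_witnessAt W t k D v₃ hv₃ P hW g hgen hcount hstub hSelSha hta w₀ hKur d
      hd hinj hgd hord
  refine deepUpper_conclusion_of_supplyWitnesses_bounded W 3 P.f hint ha hsa B fun k₀ hk₀ => ?_
  obtain ⟨k, D, κ, Λ, κ', hW, g, hgen, n₀, hcount, hstub, hSelSha, hta, w₀, hKur, d, hd, hprime, hcyc,
    hlev, hν, hinj, hgd, hord⟩ := H k₀ hk₀
  obtain ⟨n, hn0, hcycn, hlevn, hνn, γ, ψ, w, hγ, hγK, hψ, hw⟩ :=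
    EndCore.exists_certificate_of_witnessAt W t k D v₃ hv₃ P hW g hgen hcount hstub hSelSha hta w₀ hKur d hd
      hprime hcyc hlev hν hinj hgd hord
  exact ⟨n, hn0, hcycn, hlevn, hνn, k + 1, γ, ψ, w, hγ, hγK, hψ, hw⟩

end EndRow

end Summit.BirchSwinnertonDyer.BirchSwinnertonDyer.Theorems.KimAtThreeDeepUpperEndRow

end
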